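import Summits.RiemannHypothesis.RiemannHypothesis.Theorems.SignConeConeMagnificationCombTypeOfPairData
import Summits.RiemannHypothesis.RiemannHypothesis.Theorems.SignConeConeMagnificationCombTypeNorm
import Summits.RiemannHypothesis.RiemannHypothesis.Theorems.SignConeConeMagnificationStubCombLocal
import Summits.RiemannHypothesis.RiemannHypothesis.Theorems.SignConeConeMagnificationCombTypePairSum
import Summits.RiemannHypothesis.RiemannHypothesis.Theorems.SignConeConeMagnificationCombTypeSharpData

/-!
# Crux `SignCone.ConeMagnification` (stmt-RiemannHypothesis-16303), line `Sketch` r9 — the registered stub `stub_combType`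

F4 of seat-0's assembly: `stub_combType` (registered signature verbatim) := `CombType.combType_of_pairData` + the pair-level data for the
weight at hand: bump `b` from `exists_real_bump`, `B₀ = ∫ b²`, the norm node from `CombType.norm_node_eval`, the node → pair summation
`CombType.pair_difference_of_node_bounds`, and the SHARP node data `CombType.sharp_node_data` (seat-0's backstop chain over the lead's
`node_weight_pair` machinery and the wave-3 periodization / progression / family-weight lemmas).
-/

noncomputable section

-- `Summit.RiemannHypothesis.RiemannHypothesis.…` repeats a namespace component by design (D-0017 layout).
set_option linter.dupNamespace false

open scoped BigOperators ComplexConjugate Topology ArithmeticFunction.vonMangoldt ContDiff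
open Complex MeasureTheory Set Filter

namespace Summit.RiemannHypothesis.RiemannHypothesis.Theorems.SignConeConeMagnification

open Literature.NumberTheory.LFunctions
open Summit.RiemannHypothesis.RiemannHypothesis.Theorems.SignCone

/-- **`stub_combType`** (crux `SignCone.ConeMagnification`, line `Sketch` r9, registered signature verbatim): the TYPE INEQUALITY
`T(α) ≤ ½ Re Φ_α(1)` for every finitely supported complex design, for a nonnegative unit-slack weight with Chebyshev–Mertens asymptotics and
locally summable prime classes.  Seat-0 assembly (`CombType.combType_of_pairData`) over the lead's sharp comb evaluation. [folklore] -/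
theorem stub_combType :
    ∀ c : ℕ → ℝ, (∀ n, 0 ≤ c n) → c 1 = 0 →
      (∀ g : ℝ → ℂ, IsWeilTest g →
        -(∫ t, ‖g t‖ ^ 2) ≤
          (weilPolarTerm (weilConv g (weilReflect g)) + weilArchTerm (weilConv g (weilReflect g)) -
            ∑' n : ℕ, ((c n : ℝ) : ℂ) / (Real.sqrt n : ℂ) *
              (weilConv g (weilReflect g) (Real.log n) + weilConv g (weilReflect g) (-Real.log n))).re) →
      ((∃ A : ℝ, ∀ x : ℝ, 1 ≤ x → ∑ n ∈ Finset.Icc 1 ⌊x⌋₊, c n ≤ A * x) ∧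
        (∃ C : ℝ, Filter.Tendsto (fun x : ℝ => (∑ n ∈ Finset.Icc 1 ⌊x⌋₊, c n / n) - Real.log x)
          Filter.atTop (nhds C))) →
      (∀ p : ℕ, p.Prime → Summable (fun n : ℕ => if p ∣ n then c n / n else 0)) →
      (∀ α : ℕ → ℂ, ∀ L : ℕ, (∀ m, L < m → α m = 0) →
      ∀ b₁ : ℝ → ℂ, IsWeilTest b₁ → tsupport b₁ ⊆ Set.Icc (-1) 1 →
      ∀ θ : ℝ, 0 < θ → θ < 1 → ∀ ε : ℝ, 0 < ε → ∃ M₀ : ℕ, ∀ M : ℕ, M₀ ≤ M →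
        let κ : ℝ := Real.log M ^ θ
        let g : ℝ → ℂ := fun u => ∑ m ∈ Finset.range (L * M + 1),
          (∑ k ∈ (Nat.divisors m).filter (· ≤ M), α (m / k) / (Real.sqrt k : ℂ)) *
            b₁ ((u - Real.log m) * (M : ℝ) / κ)
        |(weilPolarTerm (weilConv g (weilReflect g)) + weilArchTerm (weilConv g (weilReflect g)) -
            ∑' n : ℕ, ((ArithmeticFunction.vonMangoldt n : ℝ) : ℂ) / (Real.sqrt n : ℂ) *
              (weilConv g (weilReflect g) (Real.log n) + weilConv g (weilReflect g) (-Real.log n))).re| ≤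
          ε * ∫ u, ‖g u‖ ^ 2) →
      (∀ α : ℕ → ℂ, ∀ L : ℕ, (∀ m, L < m → α m = 0) →
        ∃ T : ℝ, Filter.Tendsto (fun x : ℝ => ∑ n ∈ Finset.Icc 1 ⌊x⌋₊,
            (c n - ArithmeticFunction.vonMangoldt n) / n *
              (∑ ℓ ∈ Finset.Icc 1 L, ∑ ℓ' ∈ Finset.Icc 1 L, α ℓ * (starRingEnd ℂ) (α ℓ') *
              (((Nat.gcd (n * ℓ') ℓ : ℕ) : ℝ) : ℂ) / (Real.sqrt ((ℓ : ℝ) * ℓ') : ℂ)).re) Filter.atTop (nhds T) ∧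
          T ≤ 1 / 2 * (∑ ℓ ∈ Finset.Icc 1 L, ∑ ℓ' ∈ Finset.Icc 1 L, α ℓ * (starRingEnd ℂ) (α ℓ') *
              (((Nat.gcd (1 * ℓ') ℓ : ℕ) : ℝ) : ℂ) / (Real.sqrt ((ℓ : ℝ) * ℓ') : ℂ)).re) := by
  intro c hc0 _hc1 hU hM hLoc _hZc
  refine CombType.combType_of_pairData c hc0 hU hM.2 hLoc ?_
  intro L hL
  obtain ⟨b, hb, hbc, hbs, hb0, _hb1, hBpos⟩ := exists_real_bump
  refine ⟨b, hb, hbc, hbs, ∫ x, b x ^ 2, hBpos, ?_⟩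
  obtain ⟨N₀, N₁, N₂, hB, hB', h0, h1, h2, hBs, hB0⟩ := autocorr_package hb hbc hbs hb0
  obtain ⟨A, hA⟩ := hM.1
  have hA₁ := chebyshev_nat hA
  obtain ⟨T₀, hT₀⟩ := exists_abs_dwtSum_le c hM.2
  obtain ⟨Cn, hCn⟩ := CombType.norm_node_eval hb hbc hbs hb0 hL
  have hLR : (1 : ℝ) ≤ L := by exact_mod_cast hL
  -- Chebyshev for `Λ` and the nonnegativity of the constants
  have hΛ0 : ∀ n, (0 : ℝ) ≤ Λ n := fun n => ArithmeticFunction.vonMangoldt_nonneg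
  obtain ⟨hT00, hA'0⟩ := diff_consts_nonneg hT₀ (sum_abs_sub_vonMangoldt_le hc0 hA₁)
  have hN₀ : 0 ≤ N₀ := (abs_nonneg _).trans (h0 0)
  -- THE SHARP PER-NODE EVALUATION (`CombType.sharp_node_data`, seat-0's backstop chain …CombTypeFamilies → …CombTypeSharpData):
  -- class term `S`, error `err` with `Σ_{n ≤ 3LM} (c+Λ) err ≤ E₁ (log M)^{3/4}`.
  obtain ⟨θ', hθ'1, hθ'2, E₁, hE₁, M₁, hsharp⟩ : ∃ θ' : ℝ, 1 / 2 ≤ θ' ∧ θ' < 1 ∧ ∃ E₁ : ℝ, 0 ≤ E₁ ∧ ∃ M₁ : ℕ,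
      ∀ M : ℕ, M₁ ≤ M → 4096 * L ^ 2 ≤ M → ∀ ℓ ∈ Finset.Icc 1 L, ∀ ℓ' ∈ Finset.Icc 1 L,
        ∃ S err : ℕ → ℝ, (∀ δ, |S δ| ≤ E₁ * Real.log M ^ θ') ∧
          (∑ n ∈ Finset.Icc 1 (3 * L * M), (c n + Λ n) * err n ≤ E₁ * Real.log M ^ θ') ∧
          ∀ n ∈ Finset.Icc 1 (3 * L * M),
            |(∑ k' ∈ Finset.Icc 1 M,
                (∑ k ∈ Finset.Icc 1 M, (fun v => ∫ u, b u * b (u - v))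
                    ((Real.log ((n : ℝ) * ℓ' * k' / ℓ) - Real.log k) / (Real.sqrt (Real.log M) / M)) / Real.sqrt k)
                  / Real.sqrt k' / Real.sqrt n)
              - (fun v => ∫ u, b u * b (u - v)) 0 * (Real.sqrt ℓ / Real.sqrt ℓ') *
                  (∑ k' ∈ Finset.Icc 1 ⌊1 / (4 * (Real.sqrt (Real.log M) / M)) / ((n : ℝ) * ℓ')⌋₊,
                    (if ℓ ∣ n * ℓ' * k' then 1 / (k' : ℝ) else 0)) / n
              - (Real.sqrt (Real.log M) / M) *
                  (∫ v, (fun v => ∫ u, b u * b (u - v)) v * Real.exp (-((Real.sqrt (Real.log M) / M) * v) / 2)) *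
                  (Real.sqrt ℓ' / Real.sqrt ℓ) *
                  ((min M ⌊(ℓ : ℝ) * M * Real.exp (-(2 * (Real.sqrt (Real.log M) / M))) / (ℓ' * n)⌋₊
                      - ⌊1 / (4 * (Real.sqrt (Real.log M) / M)) / ((n : ℝ) * ℓ')⌋₊ : ℕ) : ℝ)
              - S (Nat.gcd (n * ℓ') ℓ) / n| ≤ err n :=
    ⟨3 / 4, by norm_num, by norm_num, CombType.sharp_node_data hB hB' h0 h1 h2 hBs hB0 hL hc0 hA₁⟩
  -- the constant and the exponent
  set E₂ : ℝ := 8 * N₀ * L * ((2 * T₀ + 3 * (A + (Real.log 4 + 4))) * L + (T₀ + (A + (Real.log 4 + 4)))) with hE₂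
  have hE₂0 : 0 ≤ E₂ := by positivity
  set Cst : ℝ := max Cn 1 + E₁ + E₂ with hCst
  have hCst1 : max Cn 1 ≤ Cst := by rw [hCst]; linarith
  have hCst0 : 0 ≤ Cst := le_trans (le_trans zero_le_one (le_max_right _ _)) hCst1
  refine ⟨Cst, θ', hθ'2, ?_⟩
  filter_upwards [eventually_ge_atTop (max (4096 * L ^ 2) M₁)] with M hMmax
  have hM4096 : 4096 * L ^ 2 ≤ M := le_of_max_le_left hMmax
  have hMM₁ : M₁ ≤ M := le_of_max_le_right hMmax
  intro ℓ hℓ ℓ' hℓ'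
  obtain ⟨hℓ1, hℓL⟩ := Finset.mem_Icc.1 hℓ
  obtain ⟨hℓ'1, hℓ'L⟩ := Finset.mem_Icc.1 hℓ'
  obtain ⟨hlog1, hκ1, hκlog, hh0, hhL, hhM1, hhM2, hh2, hYeq, hY1, hY2⟩ := comb_params_of_large hL hM4096
  have hMpos : 0 < M := by
    have : 1 ≤ 4096 * L ^ 2 := by nlinarith
    omega
  have hMR : (0 : ℝ) < M := by exact_mod_cast hMpos
  have hN1 : 1 ≤ 3 * L * M := by
    have : 1 ≤ 3 * L := by omega
    exact le_trans this (Nat.le_mul_of_pos_right _ hMpos)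
  have hhM : Real.sqrt (Real.log M) / M * M = Real.sqrt (Real.log M) := by field_simp
  have hpow : Real.sqrt (Real.log M) ≤ Real.log M ^ θ' := by
    rw [Real.sqrt_eq_rpow]; exact Real.rpow_le_rpow_of_exponent_le hlog1 hθ'1
  have hpow0 : 0 ≤ Real.log M ^ θ' := Real.rpow_nonneg (by linarith) _
  obtain ⟨S, err, hS, herr, hnode⟩ := hsharp M hMM₁ hM4096 ℓ hℓ ℓ' hℓ'
  refine ⟨S, fun δ => (hS δ).trans ?_, ?_, ?_⟩
  · -- `E₁ (log M)^θ' ≤ Cst (log M)^θ'`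
    exact mul_le_mul_of_nonneg_right (by rw [hCst]; linarith [le_max_right Cn 1]) hpow0
  · -- the SHARP pair difference: node → pair summation, then the error budget
    have hpd := CombType.pair_difference_of_node_bounds (B := fun v => ∫ u, b u * b (u - v)) (M := M)
      h0 hBs hB0 hL hℓ1 hℓL hℓ'1 hℓ'L hh0 hhL hhM1 hc0 hA₁ hT₀ hN1 S err hnode
    rw [hYeq, autocorr_zero] at hpd
    refine hpd.trans ?_
    have e8 : 8 * N₀ * L * (Real.sqrt (Real.log M) / M) * M *
        ((2 * T₀ + 3 * (A + (Real.log 4 + 4))) * L + (T₀ + (A + (Real.log 4 + 4)))) = E₂ * Real.sqrt (Real.log M) := by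
      rw [hE₂]; field_simp
    rw [e8]
    have hE₂ρ : E₂ * Real.sqrt (Real.log M) ≤ E₂ * Real.log M ^ θ' := mul_le_mul_of_nonneg_left hpow hE₂0
    calc (∑ n ∈ Finset.Icc 1 (3 * L * M), (c n + Λ n) * err n) + E₂ * Real.sqrt (Real.log M)
        ≤ E₁ * Real.log M ^ θ' + E₂ * Real.log M ^ θ' := by linarith [herr]
      _ ≤ Cst * Real.log M ^ θ' := by
          rw [← add_mul]
          refine mul_le_mul_of_nonneg_right ?_ hpow0
          rw [hCst]; linarith [le_max_right Cn 1]
  · -- the norm node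
    have h := hCn M hM4096 ℓ hℓ ℓ' hℓ'
    refine h.trans ?_
    calc Cn * Real.sqrt (Real.log M) ≤ max Cn 1 * Real.sqrt (Real.log M) :=
          mul_le_mul_of_nonneg_right (le_max_left _ _) (Real.sqrt_nonneg _)
      _ ≤ Cst * Real.log M ^ θ' :=
          mul_le_mul hCst1 hpow (Real.sqrt_nonneg _) hCst0

end Summit.RiemannHypothesis.RiemannHypothesis.Theorems.SignConeConeMagnification

end
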